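import Summits.Ventures.Crystal3D.Theorems.StickyWulffConstantGenericWallFloorStackWalkReverse
import HarnessLib

/-!
# The PUSH MAP of the stack walk in closed form, and the induction principle for stack invariants
# (crux `GenericWallFloor`, stmt-Ventures-19480, line `WallLedgerG`; the W1 hypothesis `hdirs` of `…StackLedgerOneSidedDirs`)

HONEST FRAMING. Venture `Summits/Ventures/Crystal3D` (cell `crystal3d-full`), helper `--supports` the crux `GenericWallFloor`
(stmt-Ventures-19480) of `route-Ventures-StickyWulffConstant`, registered line `WallLedgerG`, open stub `stub_twoSlabAdhesion`.
Rung credit only; F-C1 not moved; NOT the stub, and NOT the discharge of `hdirs` (19480-p1 g9) — only its two structural inputs.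

The W1-conditional ledger `twoSlabAdhesion_stackLedger_oneSided_dirs` (19480-p2 g8) is conditional on
`hdirs : ∀ stk, StackSound z stk → StackWF z stk → stk.getLast? = some b → ∀ e rest, stk = e :: rest → 0 ≤ (e.frame e.dir) 2`,
a property of every SOUND WELL-FORMED stack over the family's bottom entry `b`.  Such stacks are generated from `[b]` by PUSHES;
this file isolates what a discharge by induction needs:

* **`forall_mem_of_push_invariant`** — INDUCTION PRINCIPLE: a predicate `I` on entries holding at `b` and preserved by every
  admissible push (`e'` sound, linked to the old top `e`, `e'.dir` the best capper, `e'.nrm ≠ e.nrm`; the old top's direction is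
  a slot rising by `≥ 3/8` or the bottom's) holds at EVERY entry of every sound well-formed stack over `b`;
  `hdirs_of_push_invariant` — hence `hdirs` from any such `I` with `I e → 0 ≤ (e.frame e.dir) 2`;
  `hdirs_of_forall_mem_inner` — 19480-p1's ∀-entry form `δ ≤ ⟪e.frame e.dir, e₃⟫` (`0 ≤ δ`) implies `hdirs` as typed.
* **`push_dir_eq`** — THE PUSH MAP IN CLOSED FORM: if `e'` is sound and linked over `e` with `e'.dir` the best capper, then
  `e'.frame e'.dir = 2√(2/3)·n − e.frame p` (`n = e'.nrm`) for an `n`-POSITIVE slot `p` of the OLD frame (`⟪e.frame p, n⟫ = √(2/3)`)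
  that MINIMISES the `z`-height `⟪e.frame p, z⟫` among the three `n`-positive slots of the old frame (one of which is the old
  direction `e.dir`, `inner_oldDir_nrm`); with `nrm_menu_old` (`n` is a menu normal of the OLD frame too) and
  `frame_eq_twinFrame_of_link` (`e'.frame = R_n ∘ e.frame`) this is the complete transition rule
  `(F, d) ↦ (R_n F, 2√(2/3)n − F p)` of the held direction, frame-aware as 19480-p1's caveat (INBOX 17:40:50Z) requires.
WHAT THIS IS NOT: no invariant is exhibited here; `hdirs` is NOT discharged; F-C1 not moved.
-/

noncomputable section

namespace Summit.Ventures.Crystal3D.Theorems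

open Finset
open scoped InnerProductSpace

/-! ### The induction principle over sound well-formed stacks -/

/-- **Induction principle for stack invariants.**  Let `I` hold at the bottom entry `b` and be preserved by admissible pushes:
whenever `I e` (the old top, whose direction is a slot), `e'` is sound for `z`, linked to `e`, carries the best capper as
direction and a NEW normal, then `I e'`.  Then every entry of every sound well-formed stack with bottom `b` satisfies `I`. -/
theorem forall_mem_of_push_invariant {z : EuclideanSpace ℝ (Fin 3)} (I : WalkEntry → Prop) (b : WalkEntry) (h0 : I b)
    (hpush : ∀ e e' : WalkEntry, I e → e.dir ∈ fccSlots → e'.Sound z → e'.Link e →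
      e'.dir = bestCapper e'.frame e'.nrm z → e'.nrm ≠ e.nrm → I e') :
    ∀ stk : List WalkEntry, StackSound z stk → StackWF z stk → stk.getLast? = some b → ∀ e ∈ stk, I e
  | [], hS, _, _ => absurd hS (stackSound_nil z)
  | [e], _, _, hlast => by
    rw [List.getLast?_singleton] at hlast
    obtain rfl := Option.some.inj hlast
    intro x hx
    rw [List.mem_singleton] at hx
    rw [hx]; exact h0
  | e :: e' :: rest, hS, hW, hlast => by
    obtain ⟨hSo, hLi, hS'⟩ := hS
    obtain ⟨hbest, hne, hW'⟩ := hW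
    rw [List.getLast?_cons_cons] at hlast
    have IH := forall_mem_of_push_invariant I b h0 hpush (e' :: rest) hS' hW' hlast
    have hIe : I e := hpush e' e (IH e' (by simp)) hS'.top.1 hSo hLi hbest hne
    intro x hx
    rcases List.mem_cons.1 hx with rfl | hx'
    · exact hIe
    · exact IH x hx'

/-- **`hdirs` from a push invariant.**  Any push-invariant `I` over the bottom `b` with `I e → 0 ≤ (e.frame e.dir) 2` yields the
W1 hypothesis `hdirs` of `twoSlabAdhesion_stackLedger_oneSided_dirs` (top entry of every sound well-formed stack over `b`). -/
theorem hdirs_of_push_invariant {z : EuclideanSpace ℝ (Fin 3)} (I : WalkEntry → Prop) (b : WalkEntry) (h0 : I b)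
    (hpush : ∀ e e' : WalkEntry, I e → e.dir ∈ fccSlots → e'.Sound z → e'.Link e →
      e'.dir = bestCapper e'.frame e'.nrm z → e'.nrm ≠ e.nrm → I e')
    (hI : ∀ e, I e → 0 ≤ (e.frame e.dir) 2) :
    ∀ stk : List WalkEntry, StackSound z stk → StackWF z stk → stk.getLast? = some b →
      ∀ e rest, stk = e :: rest → 0 ≤ (e.frame e.dir) 2 :=
  fun stk hS hW hlast e rest hstk =>
    hI e (forall_mem_of_push_invariant I b h0 hpush stk hS hW hlast e (by rw [hstk]; simp))

/-- **19480-p1's ∀-entry form implies `hdirs` as typed.**  If every entry of every sound well-formed stack over `b` satisfies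
`δ ≤ ⟪e.frame e.dir, e₃⟫` with `0 ≤ δ`, then the top direction has non-negative true height. -/
theorem hdirs_of_forall_mem_inner {z : EuclideanSpace ℝ (Fin 3)} {b : WalkEntry} {δ : ℝ} (hδ : 0 ≤ δ)
    (h : ∀ stk : List WalkEntry, StackSound z stk → StackWF z stk → stk.getLast? = some b →
      ∀ e ∈ stk, δ ≤ ⟪e.frame e.dir, EuclideanSpace.single (2 : Fin 3) (1 : ℝ)⟫_ℝ) :
    ∀ stk : List WalkEntry, StackSound z stk → StackWF z stk → stk.getLast? = some b →
      ∀ e rest, stk = e :: rest → 0 ≤ (e.frame e.dir) 2 := by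
  intro stk hS hW hlast e rest hstk
  have h1 := h stk hS hW hlast e (by rw [hstk]; simp)
  rw [EuclideanSpace.inner_single_right] at h1
  simp only [conj_trivial, one_mul] at h1
  linarith

/-! ### The push map in closed form -/

/-- Along a link, inner products with the entry normal flip sign between the new and the old frame:
`⟪e'.frame x, n⟫ = −⟪e.frame x, n⟫` (`n = e'.nrm` a unit vector). -/
theorem inner_newFrame_nrm {e e' : WalkEntry} (hn : ‖e'.nrm‖ = 1) (hL : e'.Link e) (x : EuclideanSpace ℝ (Fin 3)) :
    ⟪e'.frame x, e'.nrm⟫_ℝ = -⟪e.frame x, e'.nrm⟫_ℝ := by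
  rw [hL.1 x, inner_sub_left, real_inner_smul_left, real_inner_self_eq_norm_sq, hn]
  ring

/-- **The entry normal is a menu normal of the OLD frame too**: `⟪e.frame w, n⟫ ∈ {0, ±√(2/3)}` for every slot `w`. -/
theorem nrm_menu_old {z : EuclideanSpace ℝ (Fin 3)} {e e' : WalkEntry} (hS' : e'.Sound z) (hL : e'.Link e) :
    ∀ w ∈ fccSlots, ⟪e.frame w, e'.nrm⟫_ℝ = 0 ∨ ⟪e.frame w, e'.nrm⟫_ℝ = Real.sqrt (2 / 3) ∨
      ⟪e.frame w, e'.nrm⟫_ℝ = -Real.sqrt (2 / 3) := by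
  intro w hw
  obtain ⟨-, hn, hmenu, -⟩ := hS'
  have h := inner_newFrame_nrm hn hL w
  rcases hmenu w hw with h0 | h1 | h2
  · left; linarith
  · right; right; linarith
  · right; left; linarith

/-- **The old direction is `n`-positive**: `⟪e.frame e.dir, e'.nrm⟫ = √(2/3)` (this is what makes POP a capper step). -/
theorem inner_oldDir_nrm {e e' : WalkEntry} (hL : e'.Link e) : ⟪e.frame e.dir, e'.nrm⟫_ℝ = Real.sqrt (2 / 3) := hL.2

/-- **THE PUSH MAP IN CLOSED FORM.**  If `e'` is sound for `z`, linked over `e`, and carries the best capper as direction, then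
for `n = e'.nrm` there is an `n`-positive slot `p` of the OLD frame (`⟪e.frame p, n⟫ = √(2/3)`) with
`e'.frame e'.dir = 2√(2/3)·n − e.frame p`, and `p` MINIMISES the `z`-height among the `n`-positive slots of the old frame. -/
theorem push_dir_eq (z : EuclideanSpace ℝ (Fin 3)) {e e' : WalkEntry} (hS' : e'.Sound z) (hL : e'.Link e)
    (hbest : e'.dir = bestCapper e'.frame e'.nrm z) :
    ∃ p ∈ fccSlots, ⟪e.frame p, e'.nrm⟫_ℝ = Real.sqrt (2 / 3) ∧
      e'.frame e'.dir = (2 * Real.sqrt (2 / 3)) • e'.nrm - e.frame p ∧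
      ∀ p' ∈ fccSlots, ⟪e.frame p', e'.nrm⟫_ℝ = Real.sqrt (2 / 3) → ⟪e.frame p, z⟫_ℝ ≤ ⟪e.frame p', z⟫_ℝ := by
  obtain ⟨hdir, hn, -, hvn, -⟩ := hS'
  have hrpos : 0 < Real.sqrt (2 / 3) := Real.sqrt_pos.2 (by norm_num)
  -- the reflected form of any vector of the new frame
  have hrefl : ∀ x, e'.frame x = e.frame x - (2 * ⟪e.frame x, e'.nrm⟫_ℝ) • e'.nrm := hL.1
  -- the old-frame inner product of the new direction
  have hv' : ⟪e.frame e'.dir, e'.nrm⟫_ℝ = -Real.sqrt (2 / 3) := by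
    have h := inner_newFrame_nrm hn hL e'.dir; rw [hvn] at h; linarith
  refine ⟨-e'.dir, neg_mem_fccSlots hdir, ?_, ?_, ?_⟩
  · rw [map_neg, inner_neg_left, hv', neg_neg]
  · rw [hrefl e'.dir, hv', map_neg]; module
  · intro p' hp' hp'n
    -- `−p'` is a positive slot of the new frame, so the best capper beats it
    have hq' : -p' ∈ fccSlots.filter fun q => 0 < ⟪e'.frame q, e'.nrm⟫_ℝ := by
      rw [Finset.mem_filter]
      refine ⟨neg_mem_fccSlots hp', ?_⟩
      rw [inner_newFrame_nrm hn hL, map_neg, inner_neg_left, hp'n, neg_neg]; exact hrpos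
    have hne : (fccSlots.filter fun q => 0 < ⟪e'.frame q, e'.nrm⟫_ℝ).Nonempty := ⟨-p', hq'⟩
    have hmax := (bestCapper_spec e'.frame e'.nrm z hne).2 (-p') hq'
    rw [← hbest] at hmax
    have h1 : e'.frame (-p') = (2 * Real.sqrt (2 / 3)) • e'.nrm - e.frame p' := by
      rw [hrefl (-p'), map_neg, inner_neg_left, hp'n]; module
    have h2 : e'.frame e'.dir = (2 * Real.sqrt (2 / 3)) • e'.nrm + e.frame e'.dir := by
      rw [hrefl e'.dir, hv']; module
    rw [h1, h2, inner_sub_left, inner_add_left, real_inner_smul_left] at hmax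
    rw [map_neg, inner_neg_left]
    linarith

/-- **The push map, packaged with the frame relation and the soundness data** (what an invariant proof consumes in one
`obtain`): `e'.frame = twinFrame e.frame n`, the closed form of the new direction with its minimising slot `p`, the old
direction is `n`-positive, `n` is a unit menu normal of the old frame of `z`-height `≥ 1/7`, and the new direction rises by
`≥ 3/8` in `z`. -/
theorem push_data (z : EuclideanSpace ℝ (Fin 3)) {e e' : WalkEntry} (hS' : e'.Sound z) (hL : e'.Link e)
    (hbest : e'.dir = bestCapper e'.frame e'.nrm z) :
    e'.frame = twinFrame e.frame e'.nrm ∧ ‖e'.nrm‖ = 1 ∧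
      (∀ w ∈ fccSlots, ⟪e.frame w, e'.nrm⟫_ℝ = 0 ∨ ⟪e.frame w, e'.nrm⟫_ℝ = Real.sqrt (2 / 3) ∨
        ⟪e.frame w, e'.nrm⟫_ℝ = -Real.sqrt (2 / 3)) ∧
      ⟪e.frame e.dir, e'.nrm⟫_ℝ = Real.sqrt (2 / 3) ∧ (1 / 7 : ℝ) ≤ ⟪e'.nrm, z⟫_ℝ ∧
      (3 / 8 : ℝ) ≤ ⟪e'.frame e'.dir, z⟫_ℝ ∧
      ∃ p ∈ fccSlots, ⟪e.frame p, e'.nrm⟫_ℝ = Real.sqrt (2 / 3) ∧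
        e'.frame e'.dir = (2 * Real.sqrt (2 / 3)) • e'.nrm - e.frame p ∧
        ∀ p' ∈ fccSlots, ⟪e.frame p', e'.nrm⟫_ℝ = Real.sqrt (2 / 3) → ⟪e.frame p, z⟫_ℝ ≤ ⟪e.frame p', z⟫_ℝ := by
  have hS'' := hS'
  obtain ⟨-, hn, -, -, hnz, hrise, -⟩ := hS''
  exact ⟨frame_eq_twinFrame_of_link hn hL, hn, nrm_menu_old hS' hL, inner_oldDir_nrm hL, hnz, hrise,
    push_dir_eq z hS' hL hbest⟩

end Summit.Ventures.Crystal3D.Theorems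

end
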